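import Literature.Algebra.GroupRings.CharpolyQuotientRankTwo
import Mathlib.RingTheory.TwoSidedIdeal.Kernel
import Mathlib.RingTheory.TwoSidedIdeal.Operations
import Mathlib.Tactic
import HarnessLib

/-!
# The quotient of `k[G]` by the rank-two Cayley–Hamilton relators is `M₂(k)` (Boston–Lenstra–Ribet)

The title statement of N. Boston, H. W. Lenstra and K. Ribet, *Quotients of group rings arising from
two-dimensional representations*, C. R. Acad. Sci. Paris 312 (1991) 323–328 [BostonLenstraRibet1991],
as a presentation: for `ρ : G → M₂(k)` multiplicative (`k` any commutative ring) with
`φ := MonoidAlgebra.lift ρ : k[G] → M₂(k)` onto, the two-sided ideal `ker φ` is GENERATED by the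
Cayley–Hamilton relators `g² - tr ρ(g) · g + det ρ(g) · 1` (`g ∈ G`)
(`ker_lift_eq_span_charpolyRel`), so `k[G] ⧸ ⟨relators⟩ ≅ M₂(k)` as `k`-algebras, `ḡ ↦ ρ(g)`
(`exists_quotient_span_charpolyRel_algEquiv`). Immediate from the kernel form
`apply_eq_zero_of_charpolyRel` (file `CharpolyQuotientRankTwo.lean`) applied to the quotient map.
-/

namespace Literature.Algebra.GroupRings

open MonoidAlgebra

section Presentation

variable {k : Type*} [CommRing k] {G : Type*} [Group G]

/-- Cayley–Hamilton for `2 × 2` matrices in the relator shape: `A² - tr A · A + det A · 1 = 0`.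
Private plumbing. [folklore] -/
private theorem matrix_fin_two_charpolyRel (A : Matrix (Fin 2) (Fin 2) k) :
    A * A - A.trace • A + A.det • (1 : Matrix (Fin 2) (Fin 2) k) = 0 := by
  ext i j
  fin_cases i <;> fin_cases j <;>
    simp [Matrix.mul_apply, Fin.sum_univ_two, Matrix.trace_fin_two, Matrix.det_fin_two] <;> ring

/-- **Boston–Lenstra–Ribet, presentation form.** If `ρ : G → M₂(k)` is multiplicative and
`MonoidAlgebra.lift ρ : k[G] → M₂(k)` is onto, its kernel is the two-sided ideal generated by
the Cayley–Hamilton relators `g² - tr ρ(g) g + det ρ(g)`, `g ∈ G`.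
[cite: BostonLenstraRibet1991, Thm. 1] -/
theorem ker_lift_eq_span_charpolyRel (ρ : G →* Matrix (Fin 2) (Fin 2) k)
    (hρ : Function.Surjective (MonoidAlgebra.lift k (Matrix (Fin 2) (Fin 2) k) G ρ)) :
    TwoSidedIdeal.ker (MonoidAlgebra.lift k (Matrix (Fin 2) (Fin 2) k) G ρ)
      = TwoSidedIdeal.span {x : MonoidAlgebra k G |
          ∃ g : G, x = of k G g * of k G g - (ρ g).trace • of k G g + (ρ g).det • 1} := by
  classical
  set φ := MonoidAlgebra.lift k (Matrix (Fin 2) (Fin 2) k) G ρ with hφ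
  set S : Set (MonoidAlgebra k G) :=
    {x | ∃ g : G, x = of k G g * of k G g - (ρ g).trace • of k G g + (ρ g).det • 1} with hS
  set J := TwoSidedIdeal.span S with hJ
  apply le_antisymm
  · -- `ker φ ≤ J`: the quotient map satisfies the relations, so it kills `ker φ`
    intro x hx
    rw [TwoSidedIdeal.mem_ker] at hx
    let ψ : MonoidAlgebra k G →ₐ[k] MonoidAlgebra k G ⧸ J.asIdeal := Ideal.Quotient.mkₐ k J.asIdeal
    have hψ : ∀ g : G, ψ (of k G g) * ψ (of k G g) - (ρ g).trace • ψ (of k G g)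
        + (ρ g).det • (1 : MonoidAlgebra k G ⧸ J.asIdeal) = 0 := by
      intro g
      have hrel : ψ (of k G g * of k G g - (ρ g).trace • of k G g + (ρ g).det • 1) = 0 := by
        change Ideal.Quotient.mk J.asIdeal _ = 0
        exact Ideal.Quotient.eq_zero_iff_mem.2
          (TwoSidedIdeal.mem_asIdeal.2 (TwoSidedIdeal.subset_span ⟨g, rfl⟩))
      simpa only [map_add, map_sub, map_mul, map_smul, map_one] using hrel
    have h0 : ψ x = 0 := apply_eq_zero_of_charpolyRel ρ hρ ψ hψ hx
    change Ideal.Quotient.mk J.asIdeal x = 0 at h0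
    exact TwoSidedIdeal.mem_asIdeal.1 (Ideal.Quotient.eq_zero_iff_mem.1 h0)
  · -- `J ≤ ker φ`: Cayley–Hamilton
    rw [TwoSidedIdeal.span_le]
    rintro _ ⟨g, rfl⟩
    rw [SetLike.mem_coe, TwoSidedIdeal.mem_ker, map_add, map_sub, map_smul, map_smul, map_mul,
      map_one]
    simp only [φ, lift_of]
    exact matrix_fin_two_charpolyRel (ρ g)

/-- **Boston–Lenstra–Ribet, title statement: `k[G] ⧸ ⟨g² - tr ρ(g) g + det ρ(g)⟩ ≅ M₂(k)`.** Under
the same hypotheses the quotient of the group ring by the Cayley–Hamilton relators is isomorphic,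
as a `k`-algebra, to the `2 × 2` matrix algebra, the class of `g` going to `ρ(g)`.
[cite: BostonLenstraRibet1991, Thm. 1] -/
theorem exists_quotient_span_charpolyRel_algEquiv (ρ : G →* Matrix (Fin 2) (Fin 2) k)
    (hρ : Function.Surjective (MonoidAlgebra.lift k (Matrix (Fin 2) (Fin 2) k) G ρ)) :
    ∃ e : (MonoidAlgebra k G ⧸ (TwoSidedIdeal.span {x : MonoidAlgebra k G |
          ∃ g : G, x = of k G g * of k G g - (ρ g).trace • of k G g + (ρ g).det • 1}).asIdeal)
        ≃ₐ[k] Matrix (Fin 2) (Fin 2) k,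
      ∀ g : G, e (Ideal.Quotient.mk _ (of k G g)) = ρ g := by
  classical
  set φ := MonoidAlgebra.lift k (Matrix (Fin 2) (Fin 2) k) G ρ with hφ
  have hker : RingHom.ker φ = (TwoSidedIdeal.span {x : MonoidAlgebra k G |
      ∃ g : G, x = of k G g * of k G g - (ρ g).trace • of k G g + (ρ g).det • 1}).asIdeal := by
    rw [← ker_lift_eq_span_charpolyRel ρ hρ]
    ext x
    rw [RingHom.mem_ker, TwoSidedIdeal.mem_asIdeal, TwoSidedIdeal.mem_ker]
  refine ⟨(Ideal.quotientEquivAlgOfEq k hker).symm.trans (Ideal.quotientKerAlgEquivOfSurjective hρ),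
    fun g => ?_⟩
  rw [AlgEquiv.trans_apply]
  have : (Ideal.quotientEquivAlgOfEq k hker).symm (Ideal.Quotient.mk _ (of k G g))
      = Ideal.Quotient.mk (RingHom.ker φ) (of k G g) := by
    rw [AlgEquiv.symm_apply_eq, Ideal.quotientEquivAlgOfEq_mk]
  rw [this, Ideal.quotientKerAlgEquivOfSurjective_mk]
  simp [φ]

end Presentation

end Literature.Algebra.GroupRings
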